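import Summits.CriticalPhenomena.Ising3DConformalLimit.Theorems.EnergyNotSigmaSquaredMoebiusLimitExistsSepMove
import Summits.CriticalPhenomena.Ising3DConformalLimit.Theorems.EnergyNotSigmaSquaredMoebiusLimitExistsMoveIneq
import Summits.CriticalPhenomena.Ising3DConformalLimit.Theorems.EnergyNotSigmaSquaredMoebiusLimitExistsPedigreeDefs
import Mathlib.Topology.MetricSpace.Thickening
import HarnessLib

/-!
# Mirror pedigrees IV: the induction on pedigree depth
(stub `pedigree_assembly` of line `only-interaction-breaks-moebius`, crux `MoebiusLimitExists`,
item stmt-CriticalPhenomena-1344, route `EnergyNotSigmaSquared`)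

`F_k(x) = ρ_pin(u k)ⁿ ⟨∏ⱼ σ_{[xⱼ/u k]}⟩_{β_c}` is the pinned rescaled critical `ℤ³` `n`-point
function at mesh `u k → 0⁺`; `SVEquicont u n K i` is single-variable asymptotic equicontinuity
of `(F_k)` at the moving index `i` on `K`; `PedigreeOK μ d n x i` says that `x` admits a MIRROR PEDIGREE of depth
`≤ d` with margin `μ` (`…PedigreeDefs.lean`). This file is "Claim(d)" of the standing disprover's
§G.4: GRANTED, as hypotheses, the statements of the sibling stubs
* `pedigreeStep` (equicontinuity of the doubled `(a+a)`-zoom on a thickening of the doubled kept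
  clusters plus an eventual bound of the `(b+b)`-zoom on a thickening of the doubled discarded
  blocks give equicontinuity of the `(a+b)`-zoom at `castAdd b i₀`),
* `pedigree_mono` (pedigree margins are `2`-Lipschitz in the sup distance),
* `svEquicont_transport` (re-indexing invariance of `SVEquicont`),
* `doubled_thickening` (compact non-coincident thickenings of the doubled images exist),
and the two-point law `⟨σ₀σ_y⟩_{β_c}‖y‖₂^{2Δ} → c > 0` (only passed on), we prove by induction on
`d`: on every compact `K ⊆ NonCoincident` all of whose points admit depth-`≤ d` pedigrees with a
common margin `μ > 0`, `SVEquicont u n K i` holds.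

* Depth `0` is the landed base case `sepMove_equicontinuity` (fed with the landed move inequality
  `moveIneq_latticeRP`), one coordinate direction `τ` at a time (`Filter.eventually_all`).
* Depth `d + 1` is LOCAL on `K` (`svEquicont_of_locally_pa`, a Lebesgue-number argument): on the
  piece `closedBall x₀ (μ/4) ∩ K` either `x₀` already has depth `≤ d` (then margin `μ/2` on the
  piece, induction), or the cut at `x₀` is admissible with margin `μ/2` on the re-indexed piece
  `K'`, every configuration within `μ/8` of the doubled image `doubledA '' K'` has depth `≤ d` with
  margin `μ/4` (induction hypothesis at order `a + a`), the doubled discarded blocks are eventually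
  bounded (`pinnedZoomLocallyBounded`), and `pedigreeStep`, `svEquicont_transport` conclude.

Helpers (names end in `_pa`): locality of `SVEquicont`; the cut functional of a cubic direction is
`2`-Lipschitz; mirrors, doubling and re-enumeration do not increase distances; re-enumeration
preserves compactness and non-coincidence. References: FILS 1978 §2 (mirrors); the pedigree
recursion is the standing disprover's (Disproof.lean §G). No definitions are introduced.
-/

noncomputable section

open Filter Topology Set Function Metric
open Literature.Probability.LatticeModels

namespace Summit.CriticalPhenomena.Ising3DConformalLimit.MoebiusLimitExistsOnlyInteraction

/-! ### Locality of single-variable asymptotic equicontinuity -/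

/-- **Locality.** Single-variable asymptotic equicontinuity on a compact set `K` follows from
single-variable asymptotic equicontinuity on a closed-ball piece `closedBall x r ∩ K` of `K`
around every point `x ∈ K` (Lebesgue-number argument: finitely many half-balls cover `K`; take
the least of the finitely many radii and moduli). [folklore] -/
theorem svEquicont_of_locally_pa {u : ℕ → ℝ} {n : ℕ} {i : Fin n}
    {K : Set (Fin n → EuclideanSpace ℝ (Fin 3))} (hK : IsCompact K)
    (h : ∀ x ∈ K, ∃ r > 0, SVEquicont u n (closedBall x r ∩ K) i) : SVEquicont u n K i := by
  choose! r hr hsv using h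
  obtain ⟨t, htK, hcover⟩ := hK.elim_nhds_subcover (fun x => ball x (r x / 2))
    (fun x hx => ball_mem_nhds x (half_pos (hr x hx)))
  intro ε hε
  choose! η hη hev using fun x (hx : x ∈ t) => hsv x (htK x hx) ε hε
  rcases t.eq_empty_or_nonempty with ht | ht
  · refine ⟨1, one_pos, Eventually.of_forall fun k x hx => ?_⟩
    have := hcover hx
    simp [ht] at this
  obtain ⟨x₁, hx₁, hmin⟩ := t.exists_min_image (fun x => min (r x / 2) (η x)) ht
  refine ⟨min (r x₁ / 2) (η x₁), lt_min (half_pos (hr x₁ (htK x₁ hx₁))) (hη x₁ hx₁), ?_⟩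
  filter_upwards [(Finset.eventually_all t).2 hev] with k hk x hx x' hx' hdiff hdist
  obtain ⟨c, hc, hxc⟩ := mem_iUnion₂.1 (hcover hx)
  rw [mem_ball] at hxc
  have hle := hmin c hc
  have h1 : dist x x' < r c / 2 := lt_of_lt_of_le hdist (hle.trans (min_le_left _ _))
  have h2 : dist x x' < η c := lt_of_lt_of_le hdist (hle.trans (min_le_right _ _))
  refine hk c hc x ⟨?_, hx⟩ x' ⟨?_, hx'⟩ hdiff h2
  · rw [mem_closedBall]
    linarith [(hr c (htK c hc)).le]
  · rw [mem_closedBall]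
    calc dist x' c ≤ dist x' x + dist x c := dist_triangle _ _ _
      _ ≤ r c := by rw [dist_comm x' x]; linarith

/-! ### Metric facts: cubic functionals, mirrors, doubling, re-enumeration -/

/-- For a cubic direction `g` the functional `v ↦ g·v` is `2`-Lipschitz with respect to the
Euclidean distance (`Σ |g j| = g·g ≤ 2`). [folklore] -/
theorem abs_rdotZ_sub_le_pa {g : Site 3} (hg : IsCubicDir g)
    (v w : EuclideanSpace ℝ (Fin 3)) : |rdotZ g v - rdotZ g w| ≤ 2 * dist v w := by
  have hD : ∀ j, |v j - w j| ≤ dist v w := fun j => by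
    rw [← Real.dist_eq]
    exact PiLp.dist_apply_le v w j
  have hterm : ∀ j, |(g j : ℝ) * (v j - w j)| ≤ (g j : ℝ) ^ 2 * dist v w := fun j => by
    rw [abs_mul]
    have habs : |(g j : ℝ)| = (g j : ℝ) ^ 2 := by
      rcases hg.1 j with h | h | h <;> simp [h]
    rw [habs]
    exact mul_le_mul_of_nonneg_left (hD j) (sq_nonneg _)
  have hsum : (g 0 : ℝ) ^ 2 + (g 1 : ℝ) ^ 2 + (g 2 : ℝ) ^ 2 ≤ 2 := by
    have h2 : zdot g g ≤ 2 := by rcases hg.2 with h | h <;> omega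
    have h2' : ((zdot g g : ℤ) : ℝ) ≤ 2 := by exact_mod_cast h2
    have hz : ((zdot g g : ℤ) : ℝ) = (g 0 : ℝ) ^ 2 + (g 1 : ℝ) ^ 2 + (g 2 : ℝ) ^ 2 := by
      simp only [zdot, Int.cast_add, Int.cast_mul, sq]
    rwa [hz] at h2'
  have e : rdotZ g v - rdotZ g w =
      (g 0 : ℝ) * (v 0 - w 0) + (g 1 : ℝ) * (v 1 - w 1) + (g 2 : ℝ) * (v 2 - w 2) := by
    simp only [rdotZ]
    ring
  rw [e]
  calc |(g 0 : ℝ) * (v 0 - w 0) + (g 1 : ℝ) * (v 1 - w 1) + (g 2 : ℝ) * (v 2 - w 2)|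
      ≤ |(g 0 : ℝ) * (v 0 - w 0)| + |(g 1 : ℝ) * (v 1 - w 1)| + |(g 2 : ℝ) * (v 2 - w 2)| :=
        abs_add_three _ _ _
    _ ≤ (g 0 : ℝ) ^ 2 * dist v w + (g 1 : ℝ) ^ 2 * dist v w + (g 2 : ℝ) ^ 2 * dist v w :=
        add_le_add (add_le_add (hterm 0) (hterm 1)) (hterm 2)
    _ = ((g 0 : ℝ) ^ 2 + (g 1 : ℝ) ^ 2 + (g 2 : ℝ) ^ 2) * dist v w := by ring
    _ ≤ 2 * dist v w := mul_le_mul_of_nonneg_right hsum dist_nonneg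

/-- The Euclidean mirror `reflectZ g T` does not increase distances (it is an isometry; for the
degenerate direction `g = 0` it is the identity). [folklore] -/
theorem dist_reflectZ_le_pa (g : Site 3) (T : ℝ) (v w : EuclideanSpace ℝ (Fin 3)) :
    dist (reflectZ g T v) (reflectZ g T w) ≤ dist v w := by
  rw [EuclideanSpace.dist_eq, EuclideanSpace.dist_eq]
  refine Real.sqrt_le_sqrt (le_of_eq ?_)
  -- `G = g·g`, `D = g·(v - w)`, and `t (t G - 1) = 0` for `t = G⁻¹` (also when `G = 0`)
  have h₃ : ((zdot g g : ℤ) : ℝ) = (g 0 : ℝ) * g 0 + (g 1 : ℝ) * g 1 + (g 2 : ℝ) * g 2 := by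
    simp only [zdot, Int.cast_add, Int.cast_mul]
  have h₂ : rdotZ g v - rdotZ g w =
      (g 0 : ℝ) * (v 0 - w 0) + (g 1 : ℝ) * (v 1 - w 1) + (g 2 : ℝ) * (v 2 - w 2) := by
    simp only [rdotZ]
    ring
  have h₁ :
      (((zdot g g : ℤ) : ℝ)⁻¹ * ((zdot g g : ℤ) : ℝ) - 1) * ((zdot g g : ℤ) : ℝ)⁻¹ = 0 := by
    rcases eq_or_ne ((zdot g g : ℤ) : ℝ) 0 with h | h
    · simp [h]
    · rw [inv_mul_cancel₀ h]
      ring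
  simp only [Fin.sum_univ_three, Real.dist_eq, reflectZ_apply, sq_abs]
  linear_combination 4 * (rdotZ g v - rdotZ g w) ^ 2 * h₁ +
    4 * (rdotZ g v - rdotZ g w) * ((zdot g g : ℤ) : ℝ)⁻¹ * h₂ -
    4 * (rdotZ g v - rdotZ g w) ^ 2 * ((zdot g g : ℤ) : ℝ)⁻¹ ^ 2 * h₃

/-- Doubling a configuration in a mirror does not increase the sup distance. [folklore] -/
theorem dist_doubledA_le_pa (g : Site 3) (T : ℝ) {a b : ℕ}
    (x x' : Fin (a + b) → EuclideanSpace ℝ (Fin 3)) :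
    dist (doubledA g T x) (doubledA g T x') ≤ dist x x' := by
  refine (dist_pi_le_iff dist_nonneg).2 fun j => ?_
  refine Fin.addCases (fun j => ?_) (fun j => ?_) j
  · rw [doubledA_left, doubledA_left]
    exact dist_le_pi_dist x x' _
  · rw [doubledA_right, doubledA_right]
    exact (dist_reflectZ_le_pa g T _ _).trans (dist_le_pi_dist x x' _)

/-- Re-enumerating configurations does not increase their sup distance. [folklore] -/
theorem dist_comp_equiv_le_pa {m n : ℕ} (e : Fin m ≃ Fin n)
    (x x' : Fin n → EuclideanSpace ℝ (Fin 3)) : dist (x ∘ ⇑e) (x' ∘ ⇑e) ≤ dist x x' :=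
  (dist_pi_le_iff dist_nonneg).2 fun j => dist_le_pi_dist x x' (e j)

/-- Re-enumerating the configurations of a compact set gives a compact set. [folklore] -/
theorem isCompact_image_comp_equiv_pa {m n : ℕ} (e : Fin m ≃ Fin n)
    {K : Set (Fin n → EuclideanSpace ℝ (Fin 3))} (hK : IsCompact K) :
    IsCompact ((fun x => x ∘ ⇑e) '' K) :=
  hK.image (Pi.continuous_precomp ⇑e)

/-- Re-enumerating non-coincident configurations gives non-coincident configurations.
[folklore] -/
theorem image_comp_equiv_subset_nonCoincident_pa {m n : ℕ} (e : Fin m ≃ Fin n)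
    {K : Set (Fin n → EuclideanSpace ℝ (Fin 3))} (hK : K ⊆ NonCoincident 3 n) :
    (fun x => x ∘ ⇑e) '' K ⊆ NonCoincident 3 m := by
  rintro _ ⟨x, hx, rfl⟩
  exact ((mem_nonCoincident x).1 (hK hx)).comp e.injective

/-! ### The stub: induction on the pedigree depth -/

/-- **Mirror pedigrees, the induction on depth (Disproof §G.4, Claim(d)).** Granted the recursion
step (`pedigreeStep`: equicontinuity of the doubled `(a+a)`-zoom on a thickening of the doubled
kept clusters and an eventual bound of the `(b+b)`-zoom on a thickening of the doubled discarded
blocks give equicontinuity of the `(a+b)`-zoom), the `2`-Lipschitz dependence of pedigree margins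
on the configuration (`pedigree_mono`), re-indexing invariance (`svEquicont_transport`) and the
existence of compact non-coincident thickenings of the doubled images (`doubled_thickening`), and
under the two-point law `⟨σ₀σ_y⟩_{β_c}‖y‖₂^{2Δ} → c > 0`: along every mesh sequence `u k → 0⁺`, for
every depth `d` and margin `μ > 0`, the pinned critical `n`-point zoom is single-variable
asymptotically equicontinuous at the index `i` on every compact set `K` of non-coincident
configurations all of whose points admit a mirror pedigree of depth `≤ d` with margin `μ`.
Depth `0` is the landed base case `sepMove_equicontinuity` (with `moveIneq_latticeRP`), one
coordinate direction at a time; depth `d + 1` is local on `K` (`svEquicont_of_locally_pa`): on the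
piece `closedBall x₀ (μ/4) ∩ K` either `x₀` already has depth `≤ d` (margin `μ/2` on the piece), or
the cut at `x₀` is admissible with margin `μ/2` on the re-indexed piece, the doubled
configurations near the doubled image have depth `≤ d` with margin `μ/4` (induction hypothesis),
the doubled discarded blocks are eventually bounded (`pinnedZoomLocallyBounded`), and the step and
the transport apply. [folklore] -/
theorem pedigree_assembly :
    (∀ u : ℕ → ℝ, Tendsto u atTop (𝓝[>] (0 : ℝ)) →
      ∀ (a b : ℕ) (i₀ : Fin a) (g : Site 3), IsCubicDir g →
      ∀ (T κ η₀ M : ℝ), 0 < κ → 0 < η₀ →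
      ∀ K : Set (Fin (a + b) → EuclideanSpace ℝ (Fin 3)), IsCompact K →
      K ⊆ NonCoincident 3 (a + b) →
      (∀ x ∈ K, (∀ j : Fin a, rdotZ g (x (Fin.castAdd b j)) + κ ≤ T) ∧
        (∀ j : Fin b, T + κ ≤ rdotZ g (x (Fin.natAdd a j)))) →
      (∀ᶠ k in atTop, ∀ z ∈ Metric.cthickening η₀ (doubledB g T '' K),
        |rescaledCorrelator (criticalCorr 3) rhoPin (b + b) (u k) z| ≤ M) →
      SVEquicont u (a + a) (Metric.cthickening η₀ (doubledA g T '' K)) (Fin.castAdd a i₀) →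
      SVEquicont u (a + b) K (Fin.castAdd b i₀)) →
    (∀ (μ r : ℝ) (d n : ℕ) (x x' : Fin n → EuclideanSpace ℝ (Fin 3)) (i : Fin n),
      PedigreeOK μ d n x i → dist x x' ≤ r → PedigreeOK (μ - 2 * r) d n x' i) →
    (∀ (u : ℕ → ℝ) (a b n : ℕ) (e : Fin (a + b) ≃ Fin n) (i₀ : Fin a)
      (K : Set (Fin n → EuclideanSpace ℝ (Fin 3))),
      SVEquicont u (a + b) ((fun x => x ∘ ⇑e) '' K) (Fin.castAdd b i₀) →
      SVEquicont u n K (e (Fin.castAdd b i₀))) →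
    (∀ (g : Site 3), IsCubicDir g → ∀ (T μ : ℝ), 0 < μ → ∀ (a b : ℕ)
      (K : Set (Fin (a + b) → EuclideanSpace ℝ (Fin 3))),
      IsCompact K → K ⊆ NonCoincident 3 (a + b) →
      (∀ x ∈ K, (∀ j : Fin a, rdotZ g (x (Fin.castAdd b j)) + μ ≤ T) ∧
        (∀ j : Fin b, T + μ ≤ rdotZ g (x (Fin.natAdd a j)))) →
      ∃ η₀ > 0, IsCompact (Metric.cthickening η₀ (doubledA g T '' K)) ∧
        Metric.cthickening η₀ (doubledA g T '' K) ⊆ NonCoincident 3 (a + a) ∧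
        IsCompact (Metric.cthickening η₀ (doubledB g T '' K)) ∧
        Metric.cthickening η₀ (doubledB g T '' K) ⊆ NonCoincident 3 (b + b)) →
    ∀ (Δ c : ℝ), 0 < c →
      Tendsto (fun y : Site 3 => criticalTwoPoint 3 y * Real.sqrt (∑ i, ((y i : ℝ)) ^ 2) ^ (2 * Δ))
        cofinite (𝓝 c) →
      ∀ u : ℕ → ℝ, Tendsto u atTop (𝓝[>] (0 : ℝ)) →
        ∀ (d : ℕ) (μ : ℝ), 0 < μ →
          ∀ (n : ℕ) (i : Fin n) (K : Set (Fin n → EuclideanSpace ℝ (Fin 3))),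
          IsCompact K → K ⊆ NonCoincident 3 n → (∀ x ∈ K, PedigreeOK μ d n x i) →
          SVEquicont u n K i := by
  intro hstep hmono htrans hthick Δ c hc hG u hu d
  induction d with
  | zero =>
    intro μ hμ n i K hK hKs hped ε hε
    choose η hη hev using fun τ : Fin 3 =>
      sepMove_equicontinuity moveIneq_latticeRP Δ c hc hG u hu n K hK hKs μ hμ i τ ε hε
    obtain ⟨τ₀, hτ₀⟩ := Finite.exists_min η
    refine ⟨η τ₀, hη τ₀, ?_⟩
    filter_upwards [eventually_all.2 hev] with k hk x hx x' hx' hdiff hdist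
    obtain ⟨τ, hsep⟩ := (pedigreeOK_zero μ x i).1 (hped x hx)
    exact hk τ x hx x' hx' hdiff hsep (lt_of_lt_of_le hdist (hτ₀ τ))
  | succ d ih =>
    intro μ hμ n i K hK hKs hped
    refine svEquicont_of_locally_pa hK fun x₀ hx₀ => ⟨μ / 4, by positivity, ?_⟩
    have hx₀ped := (pedigreeOK_succ μ d x₀ i).1 (hped x₀ hx₀)
    -- the piece `K₀ = closedBall x₀ (μ/4) ∩ K`
    suffices H : ∀ K₀ : Set (Fin n → EuclideanSpace ℝ (Fin 3)), IsCompact K₀ →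
        K₀ ⊆ NonCoincident 3 n → (∀ x ∈ K₀, dist x₀ x ≤ μ / 4) → SVEquicont u n K₀ i from
      H _ (hK.inter_left isClosed_closedBall) (fun x hx => hKs hx.2) fun x hx => by
        rw [dist_comm]
        exact mem_closedBall.1 hx.1
    intro K₀ hK₀c hK₀s hK₀d
    rcases hx₀ped with h0 | ⟨g, T, a, b, e, i₀, hg, hei, hA, hB, hdbl⟩
    · -- (a) `x₀` already has depth `≤ d`: margin `μ/2` on the piece
      exact ih (μ - 2 * (μ / 4)) (by linarith) n i K₀ hK₀c hK₀s fun x hx =>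
        hmono μ (μ / 4) d n x₀ x i h0 (hK₀d x hx)
    · -- (b) an admissible cut at `x₀`; the re-indexed piece `K'`
      have hK'c : IsCompact ((fun x => x ∘ ⇑e) '' K₀) :=
        isCompact_image_comp_equiv_pa e hK₀c
      have hK's : (fun x => x ∘ ⇑e) '' K₀ ⊆ NonCoincident 3 (a + b) :=
        image_comp_equiv_subset_nonCoincident_pa e hK₀s
      have hcut : ∀ y ∈ (fun x => x ∘ ⇑e) '' K₀,
          (∀ j : Fin a, rdotZ g (y (Fin.castAdd b j)) + μ / 2 ≤ T) ∧
          (∀ j : Fin b, T + μ / 2 ≤ rdotZ g (y (Fin.natAdd a j))) := by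
        rintro _ ⟨x, hx, rfl⟩
        have hclose : ∀ l : Fin n, |rdotZ g (x₀ l) - rdotZ g (x l)| ≤ 2 * (μ / 4) :=
          fun l => (abs_rdotZ_sub_le_pa hg (x₀ l) (x l)).trans (mul_le_mul_of_nonneg_left
            ((dist_le_pi_dist x₀ x l).trans (hK₀d x hx)) two_pos.le)
        refine ⟨fun j => ?_, fun j => ?_⟩
        · change rdotZ g (x (e (Fin.castAdd b j))) + μ / 2 ≤ T
          have h1 := abs_le.1 (hclose (e (Fin.castAdd b j)))
          linarith [h1.1, h1.2, hA j]
        · change T + μ / 2 ≤ rdotZ g (x (e (Fin.natAdd a j)))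
          have h1 := abs_le.1 (hclose (e (Fin.natAdd a j)))
          linarith [h1.1, h1.2, hB j]
      obtain ⟨η₁, hη₁, hAc, hAs, hBc, hBs⟩ :=
        hthick g hg T (μ / 2) (by positivity) a b _ hK'c hK's hcut
      -- shrink the thickening radius to `η₀ = min η₁ (μ/16)`
      have hη₀ : 0 < min η₁ (μ / 16) := lt_min hη₁ (by positivity)
      have hη₀₁ : min η₁ (μ / 16) ≤ η₁ := min_le_left _ _
      have hη₀μ : min η₁ (μ / 16) < μ / 8 := lt_of_le_of_lt (min_le_right _ _) (by linarith)
      have hSAc : IsCompact (cthickening (min η₁ (μ / 16))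
          (doubledA g T '' ((fun x => x ∘ ⇑e) '' K₀))) :=
        hAc.of_isClosed_subset isClosed_cthickening (cthickening_mono hη₀₁ _)
      have hSAs : cthickening (min η₁ (μ / 16)) (doubledA g T '' ((fun x => x ∘ ⇑e) '' K₀)) ⊆
          NonCoincident 3 (a + a) :=
        (cthickening_mono hη₀₁ _).trans hAs
      have hSBc : IsCompact (cthickening (min η₁ (μ / 16))
          (doubledB g T '' ((fun x => x ∘ ⇑e) '' K₀))) :=
        hBc.of_isClosed_subset isClosed_cthickening (cthickening_mono hη₀₁ _)
      have hSBs : cthickening (min η₁ (μ / 16)) (doubledB g T '' ((fun x => x ∘ ⇑e) '' K₀)) ⊆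
          NonCoincident 3 (b + b) :=
        (cthickening_mono hη₀₁ _).trans hBs
      -- pedigrees of depth `≤ d` with margin `μ/4` on the `A`-thickening
      have hpedA :
          ∀ z ∈ cthickening (min η₁ (μ / 16)) (doubledA g T '' ((fun x => x ∘ ⇑e) '' K₀)),
            PedigreeOK (μ - 2 * (μ / 4) - 2 * (μ / 8)) d (a + a) z (Fin.castAdd a i₀) := by
        intro z hz
        obtain ⟨_, ⟨_, ⟨x, hx, rfl⟩, rfl⟩, hdz⟩ :=
          mem_thickening_iff.1 (cthickening_subset_thickening' (by positivity) hη₀μ _ hz)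
        have h1 : PedigreeOK (μ - 2 * (μ / 4)) d (a + a) (doubledA g T (x ∘ ⇑e))
            (Fin.castAdd a i₀) :=
          hmono μ (μ / 4) d (a + a) (doubledA g T (x₀ ∘ ⇑e)) (doubledA g T (x ∘ ⇑e))
            (Fin.castAdd a i₀) hdbl (((dist_doubledA_le_pa g T _ _).trans
              (dist_comp_equiv_le_pa e x₀ x)).trans (hK₀d x hx))
        refine hmono _ (μ / 8) d (a + a) _ z _ h1 ?_
        rw [dist_comm]
        exact hdz.le
      have hsvA := ih (μ - 2 * (μ / 4) - 2 * (μ / 8)) (by linarith) (a + a)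
        (Fin.castAdd a i₀) _ hSAc hSAs hpedA
      -- the eventual bound on the `B`-thickening, the step, the transport
      obtain ⟨M, hM⟩ := pinnedZoomLocallyBounded Δ c hc hG u hu (b + b) _ hSBc hSBs
      have hsv' : SVEquicont u (a + b) ((fun x => x ∘ ⇑e) '' K₀) (Fin.castAdd b i₀) :=
        hstep u hu a b i₀ g hg T (μ / 2) (min η₁ (μ / 16)) M (by positivity) hη₀ _ hK'c hK's
          hcut hM hsvA
      have := htrans u a b n e i₀ K₀ hsv'
      rwa [hei] at this

end Summit.CriticalPhenomena.Ising3DConformalLimit.MoebiusLimitExistsOnlyInteraction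

end
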